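import Literature.NumberTheory.EllipticCurves.BSDRankZeroDensityProofs
import Literature.NumberTheory.EllipticCurves.BSDSelmerPConverseRankZeroProofs
import HarnessLib

/-!
# The rank-`0` / rank-`1` `p`-converses in `p`-Selmer-CARDINALITY currency (`#Sel^(p) = 1`, `= p`)

Topic `NumberTheory/EllipticCurves`, family `bsd`. THEOREMS ONLY (no definition, no named fact,
no instance; D-0014 / D-0026), written by the cell lead of `b2b-bsdres`
(`run/shared/lean/b2b/bsd-rank1-residual/`) for the BSD-DENSITY SPRINT (coordinator directive of
2026-08-23; cell book `cells/density/CONVERSION-QUEUE.md`, rows Q1 / Q2, glue seat D2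
`b2b-bsdres-dens-p1` — served here in the interim, per curve, on a global minimal model).

## What is proved, and why

The height-density theorem of record `Literature.NumberTheory.EllipticCurves.bsz_rankLeOne_cRank_of_pieces`
(`LeadingTermBSZResCellAssemblyProofs.lean`; Bhargava–Skinner–Zhang, arXiv:1407.1826, Cor. 26 with
Lemma 18 corrected) consumes its per-curve class theorems as ANONYMOUS binders in the currency of
the CARDINALITY of the `5`-Selmer group (the quantity Bhargava–Shankar average):
`h5 : … #Sel₅(E) = 1 → rank E(ℚ) = 0 ∧ ord_{s=1} L(E,s) = 0` and
`h9 : … #Sel₅(E) = 5 → rank E(ℚ) = 1 ∧ ord_{s=1} L(E,s) = 1` (with `E(ℚ)[5] = 0` on the set `W`,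
binder `hWtors`), whereas the printed `p`-converse theorems and the tree's kernel versions of them
speak of the `ℤ_p`-CORANK of `Sel_{p^∞}(E/ℚ)`:

* rank `0`, good ordinary `p ≥ 5`, `E[p]` irreducible — the tree THEOREM
  `analyticRank_eq_zero_of_selmerCorank_eq_zero_of_mainConjecture`
  (`BSDSelmerPConverseRankZeroProofs.lean`: `corank_{ℤ_p} Sel_{p^∞}(E/ℚ) = 0 ⟹ ord_{s=1} L(E,s) = 0`,
  below modularity `exists_isNewformOf`, Mazur's main conjecture in the form of
  Burungale–Castella–Skinner, IMRN 2025, Thm. 1.1.2 (a)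
  `burungale_castella_skinner_charIdeal_eq_padicLFunction`, and Perrin-Riou–Schneider
  `Schneider1985_order_charGenerator`; the argument of Greenberg, LNM 1716, §1 pp. 65–66);
* rank `1`, good ordinary `p ≥ 5`, hypotheses (1)–(4) of W. Zhang, Camb. J. Math. 2 (2014),
  Thm. 1.4 — the cited-only named fact `WZhang2014.thm14i_rank_one_of_selmerCorank_eq_one`
  (Thm. 1.4 (i) AS PRINTED: corank one ⟹ analytic rank = Mordell–Weil rank = 1 and `Ш` finite).

The bridge between the two currencies is the tree THEOREM `exists_selmerRank_eq_add`
(`BSDRankZeroDensityProofs.lean`): for `#Sel^(p)(E/K) = p^s`, `#E(K)[p] = p^t` one has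
`s = t + corank_{ℤ_p} Sel_{p^∞}(E/K) + 2m` for some `m ≥ 0` — the fundamental exact sequence
`0 → E(K)/p → Sel^(p) → Ш[p] → 0`, `corank Sel_{p^∞} = rank + corank Ш[p^∞]`, and the EVENNESS of
`dim_{𝔽_p} Ш[p^∞]/p` from the Cassels–Tate pairing (named fact
`WeierstrassCurve.exists_casselsTate_pairing`, bsd.S18, hypothesis `hCT` below); this is
Dokchitser, *Notes on the parity conjecture* (2013), §2, "`rk_p = rk + δ_p`,
`Ш[p^∞] ≅ (ℚ_p/ℤ_p)^{δ_p} ×` (finite group of square order)". Hence: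

* `selmerCorank_eq_zero_of_natCard_selmerGroup_eq_one`: `#Sel^(p) = 1 ⟹ corank = 0` (and
  `#E(K)[p] = 1`), over any number field;
* `selmerCorank_eq_one_of_natCard_selmerGroup_eq`: `#Sel^(p) = p` and `#E(K)[p] = 1 ⟹ corank = 1`;
* `mordellWeilRank_eq_zero_of_selmerCorank_eq_zero`: `corank = 0 ⟹ rank E(K) = 0`
  (`corank = rank + corank Ш[p^∞]`, the tree theorem `selmerCorank_eq_mordellWeilRank_add_holds`);
* `rank_zero_of_natCard_selmerGroup_eq_one_of_mainConjecture` — **the shape of `h5` per curve**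
  (good-ordinary leg): for a global minimal `W/ℚ`, `p ≥ 5` good ordinary with `E[p]` irreducible,
  `#Sel^(p)(E/ℚ) = 1 ⟹ rank E(ℚ) = 0 ∧ ord_{s=1} L(E,s) = 0`, below the three named facts of the
  corank theorem and `hCT`;
* the shape of `h9` per curve (good-ordinary leg: under Zhang's (1)–(4), `#Sel^(p)(E/ℚ) = p` and
  `#E(ℚ)[p] = 1 ⟹ rank E(ℚ) = 1 ∧ ord_{s=1} L(E,s) = 1`) is the one-line composition of
  `selmerCorank_eq_one_of_natCard_selmerGroup_eq` with
  `WZhang2014.rank_eq_one_and_analyticRank_eq_one_of_thm14i`; it is written out in the sibling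
  file `WZhang2014/SelmerCardinalityRankOne.lean` (kept apart so that this file does not import
  the cited-only Zhang fact).

What is NOT done here (left to the glue seat D2 and the shared definitions file C0 of the cell
book): the transport from the short Weierstrass model `shortWeierstrass AB` of a height pair
`(A, B)` to a global minimal model (pattern: `LeadingTermBSZOrdinaryProofs`,
`C • W = shortWeierstrass AB`), the instantiation of the sets `S₀(5) ∩ W`, `T ∩ S₁ ∩ W`, and the
multiplicative-at-`5` legs of `h5` / `h9` (Skinner 2016; Skinner–Zhang).

## References

* [BhargavaSkinnerZhang2014] M. Bhargava, C. Skinner, W. Zhang, arXiv:1407.1826, Thm. 5, Thm. 9,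
  Cor. 26 (the consuming binders).
* [WZhang2014] W. Zhang, Camb. J. Math. 2 (2014) 191–253, Thm. 1.4 (i), p. 197.
* [BurungaleCastellaSkinner2025] A. Burungale, F. Castella, C. Skinner, IMRN 2025, Thm. 1.1.2 (a),
  proof of Cor. 1.3.1 (p. 4); [GreenbergLNM1716] R. Greenberg, LNM 1716 (1999), §1 pp. 65–66.
* [Dokchitser2013ParityNotes] T. Dokchitser, *Notes on the parity conjecture*, §2;
  [SilvermanAEC2009] Thm. X.4.2, X.4.14 (Cassels–Tate).
-/

noncomputable section

open scoped Classical
open scoped AddSubgroup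
open WeierstrassCurve Literature.NumberTheory.EllipticCurves.ModularForms

namespace Literature.NumberTheory.EllipticCurves

universe u

/-! ### From `p`-Selmer cardinality to `p^∞`-Selmer corank (any number field) -/

section Currency

variable {K : Type u} [Field K] [NumberField K]

/-- **`#Sel^(p)(E/K) = 1 ⟹ corank_{ℤ_p} Sel_{p^∞}(E/K) = 0` and `#E(K)[p] = 1`**, granted the
Cassels–Tate pairing: with `#Sel^(p) = p^0` and `#E(K)[p] = p^t`, `exists_selmerRank_eq_add` gives
`0 = t + corank + 2m`. [cite: Dokchitser2013ParityNotes, §2 (`rk_p = rk + δ_p`)]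
[cite: SilvermanAEC2009, Thm X.4.2(a)] -/
theorem selmerCorank_eq_zero_of_natCard_selmerGroup_eq_one
    (hCT : exists_casselsTate_pairing (K := K)) (W : WeierstrassCurve K) [W.IsElliptic]
    (p : ℕ) [Fact p.Prime] (h : Nat.card (W.selmerGroup p) = 1) :
    W.selmerCorank p = 0 ∧ Nat.card (W.toAffine.Point[(p : ℤ)]) = 1 := by
  obtain ⟨t, ht⟩ := exists_natCard_torsionBy_eq_pow W p
  obtain ⟨m, hm⟩ := exists_selmerRank_eq_add hCT W p 0 t (by rw [pow_zero]; exact h) ht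
  have ht0 : t = 0 := by omega
  refine ⟨by omega, ?_⟩
  rw [ht, ht0, pow_zero]

/-- **`#Sel^(p)(E/K) = p` and `#E(K)[p] = 1 ⟹ corank_{ℤ_p} Sel_{p^∞}(E/K) = 1`**, granted the
Cassels–Tate pairing: with `#Sel^(p) = p^1` and `#E(K)[p] = p^0`, `exists_selmerRank_eq_add` gives
`1 = 0 + corank + 2m`, so `m = 0` and `corank = 1` (the parity from Cassels–Tate is what excludes
`corank = 0`, `dim Ш[p] = 1`). [cite: Dokchitser2013ParityNotes, §2 (`rk_p = rk + δ_p`)]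
[cite: SilvermanAEC2009, Thm X.4.2(a), Thm X.4.14] -/
theorem selmerCorank_eq_one_of_natCard_selmerGroup_eq
    (hCT : exists_casselsTate_pairing (K := K)) (W : WeierstrassCurve K) [W.IsElliptic]
    (p : ℕ) [Fact p.Prime] (h : Nat.card (W.selmerGroup p) = p)
    (ht : Nat.card (W.toAffine.Point[(p : ℤ)]) = 1) :
    W.selmerCorank p = 1 := by
  obtain ⟨m, hm⟩ := exists_selmerRank_eq_add hCT W p 1 0 (by rw [pow_one]; exact h)
    (by rw [pow_zero]; exact ht)
  omega

/-- **`corank_{ℤ_p} Sel_{p^∞}(E/K) = 0 ⟹ rank E(K) = 0`**: `corank Sel_{p^∞} = rank E(K) +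
corank Ш[p^∞]` (Greenberg, LNM 1716, §1; the tree theorem
`selmerCorank_eq_mordellWeilRank_add_holds`). [cite: Greenberg1999LNM, §1 pp. 54–57] -/
theorem mordellWeilRank_eq_zero_of_selmerCorank_eq_zero (W : WeierstrassCurve K) [W.IsElliptic]
    (p : ℕ) [Fact p.Prime] (h : W.selmerCorank p = 0) : W.mordellWeilRank = 0 := by
  have hadd := W.selmerCorank_eq_mordellWeilRank_add_holds p
  omega

end Currency

/-! ### The shape of `h5` per curve: `#Sel^(p) = 1 ⟹ rank 0`, good-ordinary leg -/

/-- **Rank-`0` converse in `p`-Selmer-cardinality currency, per curve, good-ordinary leg** (the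
shape of the binder `h5` of `bsz_rankLeOne_cRank_of_pieces`; Bhargava–Skinner–Zhang Thm. 5 restricted
to good ordinary `p`, with Skinner–Urban's hypothesis (ram) REMOVED as in Burungale–Castella–Skinner).
For a global minimal `W/ℚ`, a prime `p ≥ 5` of good ordinary reduction with `E[p]` irreducible:
`#Sel^(p)(E/ℚ) = 1 ⟹ rank E(ℚ) = 0 ∧ ord_{s=1} L(E,s) = 0`, below modularity (`hmod`), Mazur's
main conjecture (`hMC`, BCS Thm. 1.1.2 (a)), Perrin-Riou–Schneider (`hS`) and the Cassels–Tate
pairing (`hCT`): `#Sel^(p) = 1 ⟹ corank = 0`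
(`selmerCorank_eq_zero_of_natCard_selmerGroup_eq_one`) `⟹ ord = 0`
(`analyticRank_eq_zero_of_selmerCorank_eq_zero_of_mainConjecture`) and `rank = 0`
(`mordellWeilRank_eq_zero_of_selmerCorank_eq_zero`).
[cite: BhargavaSkinnerZhang2014, Thm 5 (good ordinary case)]
[cite: BurungaleCastellaSkinner2025, Thm. 1.1.2 (a) and proof of Cor. 1.3.1]
[cite: GreenbergLNM1716, §1 pp. 65–66] -/
theorem rank_zero_of_natCard_selmerGroup_eq_one_of_mainConjecture
    (hmod : exists_isNewformOf)
    (hMC : burungale_castella_skinner_charIdeal_eq_padicLFunction)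
    (hS : Schneider1985_order_charGenerator) (hCT : exists_casselsTate_pairing (K := ℚ))
    (W : WeierstrassCurve ℚ) [W.IsElliptic] [W.IsGloballyMinimal] (p : ℕ) [Fact p.Prime]
    (hp : 5 ≤ p) (hgood : W.HasGoodReductionAtPrime p) (hord : ¬ (p : ℤ) ∣ W.frobeniusTrace p)
    (hirr : W.HasIrreducibleModPGaloisRep p) (hSel : Nat.card (W.selmerGroup p) = 1) :
    W.mordellWeilRank = 0 ∧ W.analyticRank = 0 := by
  have h0 := (selmerCorank_eq_zero_of_natCard_selmerGroup_eq_one hCT W p hSel).1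
  exact ⟨mordellWeilRank_eq_zero_of_selmerCorank_eq_zero W p h0,
    analyticRank_eq_zero_of_selmerCorank_eq_zero_of_mainConjecture hmod hMC hS W p hp hgood hord hirr
      h0⟩

/-- The same with `E(ℚ)[p] = 0` recorded as well (`#E(ℚ)[p] = 1`; cf. the binder `hWtors`).
[cite: BhargavaSkinnerZhang2014, Thm 5 (good ordinary case)] -/
theorem natCard_torsionBy_eq_one_of_natCard_selmerGroup_eq_one
    (hCT : exists_casselsTate_pairing (K := ℚ)) (W : WeierstrassCurve ℚ) [W.IsElliptic]
    (p : ℕ) [Fact p.Prime] (hSel : Nat.card (W.selmerGroup p) = 1) :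
    Nat.card (W.toAffine.Point[(p : ℤ)]) = 1 := by
  convert (selmerCorank_eq_zero_of_natCard_selmerGroup_eq_one hCT W p hSel).2

end Literature.NumberTheory.EllipticCurves

end
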